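import Mathlib
import Summits.ResolutionOfSingularities.ResolutionOfSingularities.Theorems.WildQuotientsWildQuotientResolutionPthConeDefs
import Summits.ResolutionOfSingularities.ResolutionOfSingularities.Theorems.WildQuotientsWildQuotientResolutionThirdConeChartCube

/-!
# The pure-power chart `D₊(x_z^p t)` of `Bl_𝔪 (1/p)(1^a) × 𝔸^c` is an affine space, EVERY `p ≥ 2`
(crux stmt-ResolutionOfSingularities-15640 `WildQuotients.WildQuotientResolution`, line `Sketch`;
chain w45c POST-V5 S2-P2 = `ConductorOneCore p n` of bricks, stage (ii) of res-L1-w45c-plan-1's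
RULING 2026-08-27T16:07:22Z (B) / 16:20:20Z (2) — the Veronese residual brick UNIFORM IN `p`.
[OURS · L1 W4.5c] — NOT a statement of any manuscript; replaces the role of no printed item.
Owner res-L1-w45c-stub-4 (gen 4).)

Mould = res-L1-w45c-stub-2's `ThirdCone.isRegularRing_chartRing_cube` (…ThirdConeChartCube, T3) with
`3 ↦ p` and exponent shift `d_s ∈ {0,1}` (weights in `{0,1}` only):
* `PthCone.exists_vIdx_mixed` — `x_s x_z^{p−1}` is a Veronese vertex generator;
* `PthCone.isRegularRing_chartRing_purePow` — the chart ring `(cone[𝔪t])_{(x_z^p t)}` is the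
  polynomial ring `k[x_z^p, x_s x_z^{p−d_s}/x_z^p (s ≠ z)]` (explicit chart map, injective via
  `ToricExit.powSubst_injective`, onto via the master monomial identity), hence regular.
Assembly (`PthCone.blowup_regular_veronese`) in `…PthConeVeronese`. No notation (plan-1 §6 (30)).
-/

set_option linter.dupNamespace false

noncomputable section

open MvPolynomial IsLocalization AlgebraicGeometry CategoryTheory
open Literature.AlgebraicGeometry.Resolution

namespace Summit.ResolutionOfSingularities.ResolutionOfSingularities.Theorems.WildQuotientResolution.PthCone

universe u

variable (k : Type) [Field k] (n p : ℕ) (w : Fin n → ZMod p)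

/-- The weight of an exponent as a sum over all variables (`ZMod p`). [folklore] -/
theorem weight_eq_sum' (e : Fin n →₀ ℕ) : Finsupp.weight w e = ∑ s, (e s : ZMod p) * w s := by
  classical
  rw [Finsupp.weight_apply, Finsupp.sum_fintype _ _ (fun i => by simp)]
  simp only [nsmul_eq_mul]

/-- The values of the mixed exponent function, as natural numbers. [OURS · L1 W4.5c] -/
theorem mixFun_val (hp : 1 < p) (s z i : Fin n) :
    (((if i = s then 1 else if i = z then ⟨p - 1, by omega⟩ else 0 : Fin (p + 1))) : ℕ) =
      (if i = s then 1 else 0) + (if i = z ∧ i ≠ s then p - 1 else 0) := by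
  by_cases h1 : i = s
  · rw [if_pos h1, if_pos h1, if_neg (fun h => h.2 h1), add_zero, Fin.val_one',
      Nat.one_mod_eq_one.mpr (by omega)]
  · by_cases h2 : i = z
    · rw [if_neg h1, if_pos h2, if_neg h1, if_pos ⟨h2, h1⟩, zero_add]
    · rw [if_neg h1, if_neg h2, if_neg h1, if_neg (fun h => h2 h.1), add_zero, Fin.val_zero]

/-- **The mixed vertex generator** `x_s x_z^{p−1}` (`s ≠ z`, both of weight `1`) is a Veronese
vertex generator. [OURS · L1 W4.5c] -/
theorem exists_vIdx_mixed (hp : 1 < p) (s z : Fin n) (hs : w s = 1) (hz : w z = 1) (hsz : s ≠ z) :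
    ∃ v : VIdx n p w, vertexExp n p w v = Finsupp.single s 1 + Finsupp.single z (p - 1) := by
  refine ⟨⟨fun i => if i = s then 1 else if i = z then ⟨p - 1, by omega⟩ else 0, ?_, fun i hi => ?_⟩, ?_⟩
  · simp_rw [mixFun_val n p hp s z]
    rw [Finset.sum_add_distrib, Finset.sum_ite_eq' Finset.univ s, if_pos (Finset.mem_univ _)]
    have h2 : ∑ i : Fin n, (if i = z ∧ i ≠ s then p - 1 else 0) = p - 1 := by
      rw [Finset.sum_eq_single z (fun i _ hi => if_neg (fun h => hi h.1))
        (fun h => absurd (Finset.mem_univ z) h), if_pos ⟨rfl, Ne.symm hsz⟩]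
    rw [h2]; omega
  · have h1 : i ≠ s := fun h => hi (h ▸ hs)
    have h2 : i ≠ z := fun h => hi (h ▸ hz)
    show (if i = s then (1 : Fin (p + 1)) else if i = z then ⟨p - 1, by omega⟩ else 0) = 0
    rw [if_neg h1, if_neg h2]
  · ext i
    rw [vertexExp_apply, Finsupp.add_apply, Finsupp.single_apply, Finsupp.single_apply]
    show (((if i = s then 1 else if i = z then ⟨p - 1, by omega⟩ else 0 : Fin (p + 1))) : ℕ) = _
    rw [mixFun_val n p hp s z i]
    by_cases h1 : i = s
    · subst h1
      rw [if_pos rfl, if_neg (show ¬(i = z ∧ i ≠ i) from fun h => h.2 rfl),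
        if_neg (show ¬(z = i) from fun h => hsz h.symm)]
    · rw [if_neg h1, if_neg (show ¬(s = i) from fun h => h1 h.symm), zero_add, zero_add]
      by_cases h2 : i = z
      · subst h2
        rw [if_pos (show i = i ∧ i ≠ s from ⟨rfl, h1⟩), if_pos rfl]
      · rw [if_neg (show ¬(i = z ∧ i ≠ s) from fun h => h2 h.1),
          if_neg (show ¬(z = i) from fun h => h2 h.symm)]

-- many small identities in the localisation; the proof is an explicit chart map
set_option maxHeartbeats 2000000 in
/-- **(R) The pure-power chart.** The chart ring `(cone[𝔪t])_{(x_z^p t)}` of `Bl_𝔪 (1/p)(w)` (Veronese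
type: all weights in `{0,1}`, `w z = 1`) is the polynomial ring `k[x_z^p, x_s x_z^{p−d_s}/x_z^p (s ≠ z)]`
(`d_s = 1` on weight-`1` variables, `0` on passengers), in particular regular. Proof = stub-2's
`ThirdCone.isRegularRing_chartRing_cube` with `3 ↦ p` and `d_s ∈ {0,1}`. [OURS · L1 W4.5c] -/
theorem isRegularRing_chartRing_purePow (hp : 1 < p) (hw : ∀ i, w i = 0 ∨ w i = 1) (z : Fin n)
    (hz : w z = 1) :
    IsRegularRing (chartRing (vertexFamily k n p w)
      (Fintype.equivFin (VIdx n p w) (pureIdx n p w z hz))) := by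
  classical
  -- notation
  let c := vertexFamily k n p w
  let j := Fintype.equivFin (VIdx n p w) (pureIdx n p w z hz)
  let g : cone k n p w := c j
  let L := Localization.Away g
  let am : cone k n p w →+* L := algebraMap _ L
  let ι : L := IsLocalization.Away.invSelf g
  have hinv : am g * ι = 1 := IsLocalization.Away.mul_invSelf (S := L) g
  have hg : ((g : cone k n p w) : MvPolynomial (Fin n) k) = X z ^ p := by
    show ((vertexFamily k n p w (Fintype.equivFin (VIdx n p w) (pureIdx n p w z hz)) : cone k n p w) :
      MvPolynomial (Fin n) k) = X z ^ p
    rw [vertexFamily_equivFin, coe_vertexGen_pureIdx]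
  haveI : IsRegularRing (MvPolynomial (Fin n) k) := MvPolynomial.isRegularRing_of_isRegularRing k
  have hpz : ((p : ℕ) : ZMod p) = 0 := ZMod.natCast_self p
  have hp0 : 0 < p := by omega
  -- the exponent shift `d` (`= w` as a natural number)
  let d : Fin n → ℕ := fun s => if w s = 0 then 0 else 1
  have hd_le : ∀ s, d s ≤ 1 := fun s => by simp only [d]; split_ifs <;> omega
  have hd0 : ∀ s, w s = 0 → d s = 0 := fun s hs => by simp [d, hs]
  have hd1 : ∀ s, w s = 1 → d s = 1 := fun s hs => by
    have : w s ≠ 0 := by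
      rw [hs]
      haveI : Fact (1 < p) := ⟨hp⟩
      exact one_ne_zero
    simp [d, this]
  have hdw : ∀ s, ((d s : ℕ) : ZMod p) * w z = w s := by
    intro s
    rcases hw s with h0 | h1
    · rw [hd0 s h0, h0]; simp
    · rw [hd1 s h1, h1, hz]; simp
  -- the chart numerators `m s = x_s x_z^{p - d s}`
  have hm_mem : ∀ s, (X s * X z ^ (p - d s) : MvPolynomial (Fin n) k) ∈ cone k n p w := by
    intro s
    rw [mem_cone_iff]
    have h := (isWeightedHomogeneous_X k w s).mul ((isWeightedHomogeneous_X k w z).pow (p - d s))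
    have hcast : ((p - d s : ℕ) : ZMod p) = (p : ZMod p) - (d s : ZMod p) := by
      have := hd_le s
      rw [Nat.cast_sub (by omega)]
    have hdeg : w s + (p - d s) • w z = 0 := by
      rw [nsmul_eq_mul, hcast, hpz, zero_sub, neg_mul, hdw s, add_neg_cancel]
    rwa [hdeg] at h
  let mA : Fin n → cone k n p w := fun s => ⟨X s * X z ^ (p - d s), hm_mem s⟩
  have hmA : ∀ s, ((mA s : cone k n p w) : MvPolynomial (Fin n) k) = X s * X z ^ (p - d s) :=
    fun s => rfl
  -- the numerators lie in the vertex ideal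
  have hmA_mem : ∀ s, s ≠ z → mA s ∈ Ideal.span (Set.range c) := by
    intro s hs
    rcases hw s with hs0 | hs1
    · -- passenger: `x_s x_z^p = x_s · g`
      have hXs : (X s : MvPolynomial (Fin n) k) ∈ cone k n p w := by
        rw [mem_cone_iff]; simpa [hs0] using isWeightedHomogeneous_X k w s
      have h30 : p - d s = p := by rw [hd0 s hs0, Nat.sub_zero]
      have : mA s = ⟨X s, hXs⟩ * g :=
        Subtype.ext (by rw [Subalgebra.coe_mul, hmA, hg, h30])
      rw [this]
      exact Ideal.mul_mem_left _ _ (Ideal.subset_span ⟨j, rfl⟩)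
    · -- weight `1`: the mixed index `(s, z^{p-1})`
      have h31 : p - d s = p - 1 := by rw [hd1 s hs1]
      obtain ⟨vm, hvm⟩ := exists_vIdx_mixed n p w hp s z hs1 hz hs
      have : mA s = vertexGen k n p w vm := Subtype.ext (by
        rw [hmA, coe_vertexGen, hvm, h31, X_pow_eq_monomial, X, monomial_mul, one_mul])
      rw [this, ← vertexFamily_equivFin]
      exact Ideal.subset_span ⟨_, rfl⟩
  -- the chart map `φ : x_z ↦ x_z^p, x_s ↦ m_s / x_z^p`
  let v : Fin n → L := fun s => if s = z then am g else am (mA s) * ι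
  let φ : MvPolynomial (Fin n) k →ₐ[k] L := aeval v
  have hφz : φ (X z) = am g := by simp [φ, v]
  have hφs : ∀ s, s ≠ z → φ (X s) = am (mA s) * ι := fun s hs => by simp [φ, v, hs]
  have hφC : ∀ r : k, φ (C r) = am (algebraMap k (cone k n p w) r) := fun r => by
    rw [aeval_C, IsScalarTower.algebraMap_apply k (cone k n p w) L]
  -- (I) values in the blow-up algebra
  have hmem : ∀ x, (φ : MvPolynomial (Fin n) k →+* L) x ∈
      blowupAlgebra (Ideal.span (Set.range c)) (c j) := by
    intro x
    induction x using MvPolynomial.induction_on with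
    | C r => rw [RingHom.coe_coe, hφC]; exact Subalgebra.algebraMap_mem _ _
    | add p q hp hq => rw [map_add]; exact Subalgebra.add_mem _ hp hq
    | mul_X p s hp =>
      rw [map_mul]
      refine Subalgebra.mul_mem _ hp ?_
      by_cases hs : s = z
      · rw [hs, RingHom.coe_coe, hφz]; exact Subalgebra.algebraMap_mem _ _
      · rw [RingHom.coe_coe, hφs s hs]; exact div_mem_blowupAlgebra _ _ (hmA_mem s hs)
  -- (II) the master monomial identity
  let D : (Fin n →₀ ℕ) → ℕ := fun e => ∑ s ∈ Finset.univ.erase z, d s * e s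
  have hdiv : ∀ e : Fin n →₀ ℕ, Finsupp.weight w e = 0 → p ∣ e z + D e := by
    intro e he
    rw [weight_eq_sum', ← Finset.add_sum_erase _ _ (Finset.mem_univ z)] at he
    have hsum : ∑ s ∈ Finset.univ.erase z, (e s : ZMod p) * w s =
        ((D e : ℕ) : ZMod p) * w z := by
      simp only [D, Nat.cast_sum, Nat.cast_mul, Finset.sum_mul]
      refine Finset.sum_congr rfl fun s _ => ?_
      rw [← hdw s]; ring
    rw [hsum, ← add_mul, ← Nat.cast_add, hz, mul_one] at he
    exact (ZMod.natCast_eq_zero_iff _ _).mp he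
  have master : ∀ (e : Fin n →₀ ℕ) (he : Finsupp.weight w e = 0) (N : ℕ), e z + D e = p * N →
      φ (X z ^ N * ∏ s ∈ Finset.univ.erase z, X s ^ e s) =
        am ⟨monomial e 1, monomial_mem_cone k n p w he 1⟩ := by
    intro e he N hN
    have hP : φ (∏ s ∈ Finset.univ.erase z, X s ^ e s) =
        (∏ s ∈ Finset.univ.erase z, am (mA s) ^ e s) * ι ^ (∑ s ∈ Finset.univ.erase z, e s) := by
      rw [map_prod, ← Finset.prod_pow_eq_pow_sum, ← Finset.prod_mul_distrib]
      refine Finset.prod_congr rfl fun s hs => ?_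
      rw [map_pow, hφs s (Finset.ne_of_mem_erase hs), mul_pow]
    have hL : φ (X z ^ N * ∏ s ∈ Finset.univ.erase z, X s ^ e s) =
        am g ^ N * (∏ s ∈ Finset.univ.erase z, am (mA s) ^ e s) *
          ι ^ (∑ s ∈ Finset.univ.erase z, e s) := by
      rw [map_mul, map_pow, hφz, hP]; ring
    -- the identity in the cone (checked on polynomials)
    have hsum3 : (∑ s ∈ Finset.univ.erase z, (p - d s) * e s) + D e =
        p * ∑ s ∈ Finset.univ.erase z, e s := by
      simp only [D, Finset.mul_sum, ← Finset.sum_add_distrib]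
      refine Finset.sum_congr rfl fun s _ => ?_
      have := hd_le s
      rw [← add_mul, Nat.sub_add_cancel (by omega)]
    have hK : p * N + ∑ s ∈ Finset.univ.erase z, (p - d s) * e s =
        e z + p * ∑ s ∈ Finset.univ.erase z, e s := by omega
    have hA : g ^ N * ∏ s ∈ Finset.univ.erase z, mA s ^ e s =
        ⟨monomial e 1, monomial_mem_cone k n p w he 1⟩ * g ^ (∑ s ∈ Finset.univ.erase z, e s) := by
      apply Subtype.ext
      simp only [Subalgebra.coe_mul, Subalgebra.coe_pow, SubmonoidClass.coe_finsetProd, hmA, hg]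
      rw [ThirdCone.monomial_one_eq_prod_X_pow, ← Finset.mul_prod_erase _ _ (Finset.mem_univ z)]
      simp only [mul_pow, ← pow_mul, Finset.prod_mul_distrib, Finset.prod_pow_eq_pow_sum]
      calc _ = (X z : MvPolynomial (Fin n) k) ^ (p * N + ∑ s ∈ Finset.univ.erase z, (p - d s) * e s) *
              ∏ s ∈ Finset.univ.erase z, X s ^ e s := by ring
        _ = X z ^ (e z + p * ∑ s ∈ Finset.univ.erase z, e s) *
              ∏ s ∈ Finset.univ.erase z, X s ^ e s := by rw [hK]
        _ = _ := by ring
    have hA' := congrArg am hA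
    simp only [map_mul, map_pow, map_prod] at hA'
    rw [hL, hA', mul_assoc, ← mul_pow, hinv, one_pow, mul_one]
  -- the monomials of weight `0` are values of the chart map
  have hmono : ∀ (e : Fin n →₀ ℕ) (he : Finsupp.weight w e = 0),
      am ⟨monomial e 1, monomial_mem_cone k n p w he 1⟩ ∈
        Set.range (φ : MvPolynomial (Fin n) k →+* L) := by
    intro e he
    obtain ⟨N, hN⟩ := hdiv e he
    exact ⟨_, master e he N hN⟩
  have hbase : ∀ r : cone k n p w, am r ∈ Set.range (φ : MvPolynomial (Fin n) k →+* L) := by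
    rintro ⟨f, hf⟩
    let μ : (Fin n →₀ ℕ) → cone k n p w := fun e =>
      if he : Finsupp.weight w e = 0 then ⟨monomial e 1, monomial_mem_cone k n p w he 1⟩ else 0
    have hμ : ∀ (e) (he : e ∈ f.support), μ e = ⟨monomial e 1,
        monomial_mem_cone k n p w (hf (Finsupp.mem_support_iff.mp he)) 1⟩ := by
      intro e he
      have hwe : Finsupp.weight w e = 0 := hf (Finsupp.mem_support_iff.mp he)
      simp [μ, hwe]
    have hdec : (⟨f, hf⟩ : cone k n p w) = ∑ e ∈ f.support, coeff e f • μ e := by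
      apply Subtype.ext
      change f = ((∑ e ∈ f.support, coeff e f • μ e : cone k n p w) : MvPolynomial (Fin n) k)
      rw [AddSubmonoidClass.coe_finsetSum]
      conv_lhs => rw [f.as_sum]
      refine Finset.sum_congr rfl fun e he => ?_
      rw [Subalgebra.coe_smul, hμ e he, smul_monomial, smul_eq_mul, mul_one]
    rw [hdec, map_sum]
    have hmemR : ∀ e ∈ f.support, am (coeff e f • μ e) ∈ φ.range := by
      intro e he
      have hsm : am (coeff e f • μ e) = algebraMap k L (coeff e f) * am (μ e) := by
        rw [Algebra.smul_def, map_mul, IsScalarTower.algebraMap_apply k (cone k n p w) L]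
      rw [hsm]
      refine Subalgebra.mul_mem _ (Subalgebra.algebraMap_mem _ _) ?_
      rw [hμ e he]
      obtain ⟨Q, hQ⟩ := hmono e (hf (Finsupp.mem_support_iff.mp he))
      exact φ.mem_range.mpr ⟨Q, hQ⟩
    exact φ.mem_range.mp (Subalgebra.sum_mem _ hmemR)
  -- (III) the generators `c i / g` are values of the chart map
  have hgen : ∀ i, am (c i) * ι ∈ Set.range (φ : MvPolynomial (Fin n) k →+* L) := by
    intro i
    let vv := (Fintype.equivFin (VIdx n p w)).symm i
    have he0 : Finsupp.weight w (vertexExp n p w vv) = 0 := weight_vertexExp n p w vv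
    obtain ⟨N, hN⟩ := hdiv _ he0
    obtain ⟨s₀, hs₀w, hs₀e⟩ := exists_pos_of_vIdx n p w hp0 vv
    have hNpos : 1 ≤ N := by
      by_contra hN0
      have hzero : vertexExp n p w vv z + D (vertexExp n p w vv) = 0 := by
        have : N = 0 := by omega
        rw [this, mul_zero] at hN; exact hN
      have hs₀e' : 1 ≤ vertexExp n p w vv s₀ := hs₀e
      by_cases hsz : s₀ = z
      · rw [hsz] at hs₀e'; omega
      · have hle : d s₀ * vertexExp n p w vv s₀ ≤ D (vertexExp n p w vv) :=
          Finset.single_le_sum (f := fun s => d s * vertexExp n p w vv s) (fun _ _ => Nat.zero_le _)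
            (Finset.mem_erase.mpr ⟨hsz, Finset.mem_univ _⟩)
        have h1 : 1 ≤ d s₀ * vertexExp n p w vv s₀ := by
          rw [hd1 s₀ hs₀w, one_mul]; exact hs₀e'
        omega
    have hm := master _ he0 N hN
    have hcg : (⟨monomial (vertexExp n p w vv) 1, monomial_mem_cone k n p w he0 1⟩ : cone k n p w) =
        c i := by
      show vertexGen k n p w vv = vertexFamily k n p w i
      simp [vv, vertexFamily]
    rw [hcg, ← Nat.sub_add_cancel hNpos, pow_succ', mul_assoc, map_mul, hφz] at hm
    refine ⟨X z ^ (N - 1) * ∏ s ∈ Finset.univ.erase z, X s ^ vertexExp n p w vv s, ?_⟩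
    rw [RingHom.coe_coe]
    calc φ (X z ^ (N - 1) * ∏ s ∈ Finset.univ.erase z, X s ^ vertexExp n p w vv s)
        = φ (X z ^ (N - 1) * ∏ s ∈ Finset.univ.erase z, X s ^ vertexExp n p w vv s) *
            (am g * ι) := by rw [hinv, mul_one]
      _ = am (c i) * ι := by rw [← hm]; ring
  -- (IV) injectivity: `Ψ ∘ Θ ∘ φ = alg ∘ E`
  let A' := Localization.Away (X z : MvPolynomial (Fin n) k)
  let alg : MvPolynomial (Fin n) k →+* A' := algebraMap _ A'
  have halg : Function.Injective alg :=
    JordanThree.algebraMap_away_injective k n (X z) (X_ne_zero z)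
  let θ : cone k n p w →+* MvPolynomial (Fin n) k := (cone k n p w).val.toRingHom
  have hθ : ∀ r : cone k n p w, θ r = (r : MvPolynomial (Fin n) k) := fun r => rfl
  have hunit : IsUnit ((alg.comp θ) g) := by
    change IsUnit (alg (θ g))
    rw [hθ, hg, map_pow]
    exact (IsLocalization.Away.algebraMap_isUnit (S := A') (X z)).pow p
  let Θ : L →+* A' := IsLocalization.Away.lift g hunit
  have hΘam : ∀ r, Θ (am r) = alg (r : MvPolynomial (Fin n) k) := fun r =>
    IsLocalization.Away.lift_eq g hunit r
  have hΘι : alg (X z) ^ p * Θ ι = 1 := by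
    have h : Θ (am g * ι) = 1 := by rw [hinv, map_one]
    rwa [map_mul, hΘam, hg, map_pow] at h
  let ψ : MvPolynomial (Fin n) k →ₐ[k] MvPolynomial (Fin n) k :=
    aeval fun s => if s = z then X z else X s * X z ^ d s
  have hψz : ψ (X z) = X z := by simp [ψ]
  have hψs : ∀ s, s ≠ z → ψ (X s) = X s * X z ^ d s := fun s hs => by simp [ψ, hs]
  have hψC : ∀ r : k, ψ (C r) = C r := fun r => ψ.commutes r
  have hle : Submonoid.powers (X z : MvPolynomial (Fin n) k) ≤
      (Submonoid.powers (X z : MvPolynomial (Fin n) k)).comap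
        (ψ : MvPolynomial (Fin n) k →+* MvPolynomial (Fin n) k) := by
    rintro _ ⟨m, rfl⟩
    exact ⟨m, by rw [RingHom.coe_coe, map_pow, hψz]⟩
  let Ψ : A' →+* A' :=
    IsLocalization.map A' (ψ : MvPolynomial (Fin n) k →+* MvPolynomial (Fin n) k) hle
  have hΨ : ∀ f, Ψ (alg f) = alg (ψ f) := fun f => IsLocalization.map_eq hle f
  have hΨΘι : alg (X z) ^ p * Ψ (Θ ι) = 1 := by
    have h := congrArg Ψ hΘι
    rwa [map_mul, map_pow, hΨ, hψz, map_one] at h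
  let E : MvPolynomial (Fin n) k →ₐ[k] MvPolynomial (Fin n) k :=
    aeval fun s => if s = z then X z ^ p else X s
  have hEz : E (X z) = X z ^ p := by simp [E]
  have hEs : ∀ s, s ≠ z → E (X s) = X s := fun s hs => by simp [E, hs]
  have hEC : ∀ r : k, E (C r) = C r := fun r => E.commutes r
  have hcomp : (Ψ.comp Θ).comp (φ : MvPolynomial (Fin n) k →+* L) =
      alg.comp (E : MvPolynomial (Fin n) k →+* MvPolynomial (Fin n) k) := by
    refine MvPolynomial.ringHom_ext (fun r => ?_) (fun s => ?_)
    · simp only [RingHom.coe_comp, RingHom.coe_coe, Function.comp_apply]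
      rw [hφC, hΘam, Subalgebra.coe_algebraMap, MvPolynomial.algebraMap_eq, hΨ, hψC, hEC]
    · simp only [RingHom.coe_comp, RingHom.coe_coe, Function.comp_apply]
      by_cases hs : s = z
      · rw [hs, hφz, hΘam, hg, hΨ, map_pow, hψz, hEz]
      · have h33 : d s + (p - d s) = p := by have := hd_le s; omega
        rw [hφs s hs, map_mul, hΘam, hmA, map_mul Ψ, hΨ, map_mul ψ, hψs s hs, map_pow, hψz,
          mul_assoc (X s), ← pow_add, h33, map_mul alg, map_pow, mul_assoc, hΨΘι, mul_one,
          hEs s hs]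
  have hinj : Function.Injective (φ : MvPolynomial (Fin n) k →+* L) := by
    intro p₁ q₁ hpq
    have h1 : alg (E p₁) = alg (E q₁) := by
      have h := congrArg (Ψ.comp Θ) hpq
      have hp₁ := RingHom.congr_fun hcomp p₁
      have hq₁ := RingHom.congr_fun hcomp q₁
      rw [RingHom.comp_apply] at hp₁ hq₁
      rw [hp₁, hq₁] at h
      simpa only [RingHom.coe_comp, RingHom.coe_coe, Function.comp_apply] using h
    have h2 : E p₁ = E q₁ := halg h1
    exact ToricExit.powSubst_injective k n z p hp0 h2
  -- conclusion
  have hrange := JordanThree.range_eq_blowupAlgebra_of_chart c j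
    (φ : MvPolynomial (Fin n) k →+* L) hmem hbase hgen
  exact JordanThree.isRegularRing_chartRing_of_chart c j (φ : MvPolynomial (Fin n) k →+* L)
    hinj hrange

end Summit.ResolutionOfSingularities.ResolutionOfSingularities.Theorems.WildQuotientResolution.PthCone

end
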